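import Literature.AlgebraicGeometry.Modules.SheafHomPullbackIso
import Literature.AlgebraicGeometry.Modules.SheafHomFrames
import Literature.AlgebraicGeometry.Modules.SheafHomLeft
import Literature.AlgebraicGeometry.Modules.PullbackAlgebraUnit
import HarnessLib

/-!
# Pull-back commutes with duals and twists: `f^*(E^∨) ≅ (f^*E)^∨` and `f^* 𝓗om(E^∨, G) ≅ 𝓗om((f^*E)^∨, f^*G)` for `E` finite locally free

Layer `Literature/AlgebraicGeometry/Modules`; sequel to `SheafHomPullbackIso.lean` (`isIso_sheafHomPullbackComparison`: the base-change
morphism `f^* 𝓗om(A, M) ⟶ 𝓗om(f^*A, f^*M)` is an isomorphism for `A` finite locally free, Görtz–Wedhorn I Ex. 7.20 (a)). For a morphism of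
schemes `f : X ⟶ Y` and an `𝒪_Y`-module `E` (`E^∨ = 𝓗om(E, 𝒪)`, the tree's `dual`; `E ⊗ G` is modelled as `𝓗om(E^∨, G)`, `twistFunctor` ∕
`twistHodge` of the Hodge-theory files):

* `pullbackDualComparison f E : f^*(E^∨) ⟶ (f^*E)^∨` — the comparison for `M = 𝒪_Y` followed by `𝓗om(f^*E, u_f)`, `u_f : f^*𝒪_Y ⟶ 𝒪_X` the
  transpose of the algebra unit (an isomorphism, `Modules/PullbackAlgebraUnit`); an ISOMORPHISM for `E` finite locally free
  (`isIso_pullbackDualComparison`, `pullbackDualIso`);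
* `pullbackTwistComparison f hE G : f^* 𝓗om(E^∨, G) ⟶ 𝓗om((f^*E)^∨, f^*G)` for `E` finite locally free — the comparison for `A = E^∨`
  followed by precomposition with `(pullbackDualIso)⁻¹`; an ISOMORPHISM (`isIso_pullbackTwistComparison`, `pullbackTwistIso`), natural in
  `G` (`pullbackTwistComparison_naturality`).

Hartshorne II Ex. 5.1 (b)(d) / Görtz–Wedhorn I Ex. 7.20 (a): pull-back of locally free sheaves of finite rank commutes with `∨`, `𝓗om` and `⊗`.
Motivation: the twist comparison `q^*(K ⊗ Ω^q_Y) ⟶ q^*K ⊗ Ω^q_P` (this file's `pullbackTwistComparison` followed by `𝓗om((q^*K)^∨, dq)`) of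
steps (Q4)/(Q5) of the library item (L2) `SigmaPullbackCompat` (crux stmt-HodgeConjecture-26512); nothing of that crux is asserted here.
Everything is proved; no named facts.

## References

* U. Görtz, T. Wedhorn, *Algebraic Geometry I: Schemes*, 2nd ed. (2020), (7.8.3) and Exercise 7.20 (a). [GortzWedhorn2020]
* R. Hartshorne, *Algebraic Geometry*, GTM 52 (1977), II Ex. 5.1 (b), (d); II.5 p. 110. [Hartshorne1977]
* The Stacks Project, Tag 01AK (`f^*𝒪_Y = 𝒪_X`), Tag 01CM. [StacksProject]
-/

noncomputable section

-- `TopCat.Presheaf`/`Scheme.Modules` are not reducible (as in Mathlib's `AlgebraicGeometry/Modules/Sheaf.lean`).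
set_option backward.isDefEq.respectTransparency false

open CategoryTheory AlgebraicGeometry Opposite TopologicalSpace Limits

universe u

namespace Literature.AlgebraicGeometry.Modules

open Literature.AlgebraicGeometry.Motives

variable {X Y : Scheme.{u}} (f : X ⟶ Y)

/-! ### `f^*𝒪_Y ⟶ 𝒪_X` -/

/-- `u_f : f^*𝒪_Y ⟶ 𝒪_X`, the transpose `f^*(f♯) ≫ ε` of the algebra unit (an isomorphism, `isIso_pullback_map_algebraUnit_comp_counit`).
[cite: StacksProject, Tag 01AK] -/
abbrev pullbackUnitComparison : (Scheme.Modules.pullback f).obj (unitModule Y) ⟶ unitModule X :=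
  (Scheme.Modules.pullback f).map (algebraUnit f) ≫ (Scheme.Modules.pullbackPushforwardAdjunction f).counit.app (unitModule X)

/-- `u_f` is an isomorphism. [cite: StacksProject, Tag 01AK] -/
theorem isIso_pullbackUnitComparison : IsIso (pullbackUnitComparison f) :=
  isIso_pullback_map_algebraUnit_comp_counit f

/-! ### The dual -/

variable (E : Y.Modules)

/-- **`f^*(E^∨) ⟶ (f^*E)^∨`**: the base-change morphism of `𝓗om(E, 𝒪_Y)` followed by `𝓗om(f^*E, u_f)`.
[cite: Hartshorne1977, II Ex. 5.1 (b) and (d)] [cite: GortzWedhorn2020, (7.8.3) and Exercise 7.20 (a)] -/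
def pullbackDualComparison : (Scheme.Modules.pullback f).obj (dual E) ⟶ dual ((Scheme.Modules.pullback f).obj E) :=
  sheafHomPullbackComparison f E (unitModule Y) ≫ sheafHomMap ((Scheme.Modules.pullback f).obj E) (pullbackUnitComparison f)

variable {E}

/-- **`f^*(E^∨) ⟶ (f^*E)^∨` is an isomorphism for `E` finite locally free.** [cite: Hartshorne1977, II Ex. 5.1 (b) and (d)]
[cite: GortzWedhorn2020, (7.8.3) and Exercise 7.20 (a)] -/
theorem isIso_pullbackDualComparison (hE : IsFiniteLocallyFree E) : IsIso (pullbackDualComparison f E) := by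
  haveI := isIso_sheafHomPullbackComparison f hE (unitModule Y)
  haveI := isIso_pullbackUnitComparison f
  haveI : IsIso (sheafHomMap ((Scheme.Modules.pullback f).obj E) (pullbackUnitComparison f)) :=
    inferInstanceAs (IsIso ((sheafHomFunctor ((Scheme.Modules.pullback f).obj E)).map (pullbackUnitComparison f)))
  exact IsIso.comp_isIso

/-- **`f^*(E^∨) ≅ (f^*E)^∨`** for `E` finite locally free. [cite: Hartshorne1977, II Ex. 5.1 (b) and (d)] -/
def pullbackDualIso (hE : IsFiniteLocallyFree E) :
    (Scheme.Modules.pullback f).obj (dual E) ≅ dual ((Scheme.Modules.pullback f).obj E) :=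
  haveI := isIso_pullbackDualComparison f hE
  asIso (pullbackDualComparison f E)

/-- The forward map of `pullbackDualIso`. [cite: Hartshorne1977, II Ex. 5.1 (b) and (d)] -/
theorem pullbackDualIso_hom (hE : IsFiniteLocallyFree E) : (pullbackDualIso f hE).hom = pullbackDualComparison f E := by
  rfl

/-! ### The twist `𝓗om(E^∨, G)` -/

variable (hE : IsFiniteLocallyFree E) (G : Y.Modules)

/-- **`f^* 𝓗om(E^∨, G) ⟶ 𝓗om((f^*E)^∨, f^*G)`** for `E` finite locally free: the base-change morphism for `A = E^∨` followed by
precomposition with `((f^*E)^∨ ≅ f^*(E^∨))` (the inverse of `pullbackDualIso`). In the tree's model `E ⊗ G = 𝓗om(E^∨, G)` this is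
`f^*(E ⊗ G) ⟶ f^*E ⊗ f^*G`. [cite: Hartshorne1977, II Ex. 5.1 (b) and (d)] [cite: GortzWedhorn2020, (7.8.3) and Exercise 7.20 (a)] -/
def pullbackTwistComparison :
    (Scheme.Modules.pullback f).obj (sheafHom (dual E) G) ⟶
      sheafHom (dual ((Scheme.Modules.pullback f).obj E)) ((Scheme.Modules.pullback f).obj G) :=
  sheafHomPullbackComparison f (dual E) G ≫ sheafHomMapLeft (pullbackDualIso f hE).inv ((Scheme.Modules.pullback f).obj G)

/-- **`f^* 𝓗om(E^∨, G) ⟶ 𝓗om((f^*E)^∨, f^*G)` is an isomorphism** (`E^∨` is finite locally free, `isFiniteLocallyFree_dual`).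
[cite: Hartshorne1977, II Ex. 5.1 (b) and (d)] [cite: GortzWedhorn2020, (7.8.3) and Exercise 7.20 (a)] -/
theorem isIso_pullbackTwistComparison : IsIso (pullbackTwistComparison f hE G) := by
  haveI := isIso_sheafHomPullbackComparison f (isFiniteLocallyFree_dual hE) G
  haveI : IsIso (sheafHomMapLeft (pullbackDualIso f hE).inv ((Scheme.Modules.pullback f).obj G)) :=
    ⟨sheafHomMapLeft (pullbackDualIso f hE).hom _,
      by rw [← sheafHomMapLeft_comp, Iso.hom_inv_id, sheafHomMapLeft_id],
      by rw [← sheafHomMapLeft_comp, Iso.inv_hom_id, sheafHomMapLeft_id]⟩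
  exact IsIso.comp_isIso

/-- **`f^* 𝓗om(E^∨, G) ≅ 𝓗om((f^*E)^∨, f^*G)`** for `E` finite locally free (`f^*(E ⊗ G) ≅ f^*E ⊗ f^*G` in the `𝓗om(E^∨, –)` model).
[cite: Hartshorne1977, II Ex. 5.1 (b) and (d)] -/
def pullbackTwistIso :
    (Scheme.Modules.pullback f).obj (sheafHom (dual E) G) ≅
      sheafHom (dual ((Scheme.Modules.pullback f).obj E)) ((Scheme.Modules.pullback f).obj G) :=
  haveI := isIso_pullbackTwistComparison f hE G
  asIso (pullbackTwistComparison f hE G)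

variable {G}

/-- **Naturality of the twist comparison in `G`**: `f^* 𝓗om(E^∨, g) ≫ t_{G'} = t_G ≫ 𝓗om((f^*E)^∨, f^*g)`.
[cite: StacksProject, Tag 01CM] -/
theorem pullbackTwistComparison_naturality {G' : Y.Modules} (g : G ⟶ G') :
    (Scheme.Modules.pullback f).map (sheafHomMap (dual E) g) ≫ pullbackTwistComparison f hE G' =
      pullbackTwistComparison f hE G ≫
        sheafHomMap (dual ((Scheme.Modules.pullback f).obj E)) ((Scheme.Modules.pullback f).map g) := by
  rw [pullbackTwistComparison, pullbackTwistComparison, ← Category.assoc, sheafHomPullbackComparison_naturality,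
    Category.assoc, Category.assoc, sheafHomMapLeft_sheafHomMap]

end Literature.AlgebraicGeometry.Modules

end
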